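import Mathlib
import Summits.PneNP.PneNP.Theorems.SymmetryBudgetHamCompilesIface
import Summits.PneNP.PneNP.Theorems.SymmetryBudgetHamCompilesStubCutspanPairing
import Summits.PneNP.PneNP.Theorems.SymmetryBudgetHamCompilesStubCutspanWindow

/-!
# Stub `stub_cutspan` of line `kotzig-cutspan` for crux `SymmetryBudget.HamCompiles`
(item stmt-PneNP-10637, route route-PneNP-SymmetryBudget)

**`KotzigPred (Gr m x) (freeSet m) ↔ Residue₀ m x` for `m ≥ 4`**
(Bodlaender–Cygan–Kratsch–Nederlof cut parity + linearity). The Kotzig junction interface of the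
route's graph `Gr m x` relative to the free set (the last `g(m) = ⌊log₂ m⌋` vertices) speaks of
CLASS labels (`cls m x = nbA (Gr m x) (freeSet m)`); the residual predicate `Residue₀` speaks of
RANK labels, of the A-block `aData m x`, and of the span `W_F(d)` of the cut vectors of the
F-covers with margins `d`. The proof:

* (labels) ranks name classes (`key` injective ⇒ `rankOf` injective on the classes present;
  auxiliary file `…StubCutspanWindow`): the rank table `r` and the class table `N` translate
  labelled A-families and junction graphs in both directions
  (`reachable_rank_of_reachable_cls` / `reachable_cls_of_reachable_rank`, same file); a label in
  use has a positive slot count, hence is the class (resp. the rank) of an end of an F-path, a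
  free vertex (slot-count bookkeeping in `…StubCutspanPairing`);
* (A-block) the anchored graph `fromRel (aData ∘ inl)` has the adjacency of `Gr m x` between
  anchored vertices (`adjA_iff`), so A-covers transport; `aData ∘ inr` validates exactly class
  membership;
* (cut parity, `pairing_eq_one_iff` of `…StubCutspanPairing`, from `cutParity` of
  `…StubCutspanCutParity`) `∑_S uF S · vA S = 1` iff the rank-labelled junction graph is
  connected on the support of `d`;
* (linearity, `exists_mem_span_pairing_iff` of `…StubCutspanCutParity`) a vector of `W_F(d)` with
  odd pairing exists iff some generator `uF (rk m x) PF` has odd pairing;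
* margins of a cover: `∑_i d i = 2 |PF| ≤ 2 g(m)`.
-/

-- `Summit.PneNP.PneNP.…` duplicates `PneNP` BY DESIGN (single-problem summit, D-0017).
set_option linter.dupNamespace false

noncomputable section

namespace Summit.PneNP.PneNP.Theorems.HamCompilesKC

open Finset

namespace Cutspan

section Main

variable {m : ℕ} (x : Fin m × Fin m → Bool)

/-- Adjacency of the anchored graph read off the A-block: the adjacency of `Gr m x` between
anchored vertices (the diagonal bit is dropped by `fromRel`). -/
theorem adjA_iff (u v : Fin m) :
    (SimpleGraph.fromRel fun u v : Fin m => aData m x (Sum.inl (u, v)) = true).Adj u v ↔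
      IsAnch m u ∧ IsAnch m v ∧ (Gr m x).Adj u v := by
  unfold Gr
  rw [SimpleGraph.fromRel_adj, SimpleGraph.fromRel_adj]
  simp only [aData, decide_eq_true_eq]
  tauto

/-- The class-membership table: `aData (inr (i, a))` holds iff `a` lies in the class of some free
vertex of rank `i`. -/
theorem aData_inr_iff (i : Fin (gOf m)) (a : Fin m) :
    aData m x (Sum.inr (i, a)) = true ↔ ∃ u ∈ freeSet m, rk m x u = (i : ℕ) ∧ a ∈ cls m x u := by
  simp [aData]

/-- Anchored = not free. -/
theorem mem_compl_freeSet_iff (v : Fin m) : v ∈ (freeSet m)ᶜ ↔ IsAnch m v := by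
  simp [freeSet]

/-- The ends of the paths of an F-cover are free. -/
theorem ends_mem {PF : List (VSeq (Fin m))} (hcov : IsCoverOf (Gr m x) (freeSet m) PF) :
    ∀ p ∈ PF, p.first ∈ freeSet m ∧ p.last ∈ freeSet m :=
  fun _ hp => ⟨first_mem_of_cover hcov hp, last_mem_of_cover hcov hp⟩

/-- **(⇒)** From the Kotzig interface to the residual predicate: margins `d i = fSlots rk PF i`,
the A-family relabelled by ranks, the generator `uF (rk m x) PF ∈ W_F(d)`, odd pairing by cut
parity from the connectivity of the junction graph. -/
theorem residue₀_of_kotzigPred (hm : 4 ≤ m) (h : KotzigPred (Gr m x) (freeSet m)) :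
    Residue₀ m x := by
  classical
  obtain ⟨PF, PA, hcov, hcovA, hlab, hbal, hreach⟩ := h
  change ∀ N, fSlots (cls m x) PF N = aSlots PA N at hbal
  change ∀ N N', 0 < fSlots (cls m x) PF N → 0 < fSlots (cls m x) PF N' →
    (junctionGraph (cls m x) PF PA).Reachable N N' at hreach
  have hends := ends_mem x hcov
  obtain ⟨r, hr⟩ := exists_rankFin hm x
  -- labels in use are classes of free vertices
  have hPAcls : ∀ q ∈ PA,
      (∃ u ∈ freeSet m, q.2.1 = cls m x u) ∧ (∃ u ∈ freeSet m, q.2.2 = cls m x u) := by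
    have hx : ∀ N, 0 < aSlots PA N → ∃ u ∈ freeSet m, N = cls m x u := by
      intro N hN
      rw [← hbal, fSlots_pos_iff] at hN
      obtain ⟨p, hp, h | h⟩ := hN
      · exact ⟨_, (hends p hp).1, h.symm⟩
      · exact ⟨_, (hends p hp).2, h.symm⟩
    intro q hq
    exact ⟨hx _ ((aSlots_pos_iff PA _).2 ⟨q, hq, Or.inl rfl⟩),
      hx _ ((aSlots_pos_iff PA _).2 ⟨q, hq, Or.inr rfl⟩)⟩
  -- the data of `Residue₀`
  set d : Fin (gOf m) → ℕ := fun i => fSlots (rk m x) PF (i : ℕ) with hd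
  set PA' : List (VSeq (Fin m) × (Fin (gOf m) × Fin (gOf m))) :=
    PA.map fun q => (q.1, (r q.2.1, r q.2.2)) with hPA'
  set lab' : Fin m → Fin (gOf m) := fun v => r (cls m x v) with hlab'_def
  have hlab' : ∀ u ∈ freeSet m, (lab' u : ℕ) = rk m x u := hr
  -- balance at every rank
  have hbal' : ∀ i, aSlots PA' i = d i := by
    intro i
    rw [hPA', aSlots_map]
    by_cases hi : ∃ u ∈ freeSet m, rk m x u = (i : ℕ)
    · obtain ⟨u₀, hu₀, hi⟩ := hi
      have h1 : d i = fSlots (cls m x) PF (cls m x u₀) := by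
        apply fSlots_congr
        intro p hp
        refine ⟨⟨fun h => ?_, fun h => ?_⟩, ⟨fun h => ?_, fun h => ?_⟩⟩
        · exact cls_eq_of_rk_eq m x (hends p hp).1 hu₀ (h.trans hi.symm)
        · exact (congrArg (rankOf m x) h).trans hi
        · exact cls_eq_of_rk_eq m x (hends p hp).2 hu₀ (h.trans hi.symm)
        · exact (congrArg (rankOf m x) h).trans hi
      have h2 : aSlots PA (cls m x u₀) = PA.countP (fun q => decide (r q.2.1 = i)) +
          PA.countP (fun q => decide (r q.2.2 = i)) := by
        apply aSlots_congr PA (cls m x u₀) (fun q => r q.2.1 = i) (fun q => r q.2.2 = i)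
        intro q hq
        obtain ⟨⟨u, hu, hqu⟩, ⟨v, hv, hqv⟩⟩ := hPAcls q hq
        rw [hqu, hqv]
        refine ⟨⟨fun h => ?_, fun h => ?_⟩, ⟨fun h => ?_, fun h => ?_⟩⟩
        · rw [h]; exact Fin.ext ((hr u₀ hu₀).trans hi)
        · apply cls_eq_of_rk_eq m x hu hu₀; rw [← hr u hu, h, hi]
        · rw [h]; exact Fin.ext ((hr u₀ hu₀).trans hi)
        · apply cls_eq_of_rk_eq m x hv hu₀; rw [← hr v hv, h, hi]
      rw [h1, hbal, h2]
    · have h1 : d i = 0 := by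
        apply Nat.eq_zero_of_not_pos
        intro hpos
        rw [hd, fSlots_pos_iff] at hpos
        obtain ⟨p, hp, h | h⟩ := hpos
        · exact hi ⟨_, (hends p hp).1, h⟩
        · exact hi ⟨_, (hends p hp).2, h⟩
      have h2 : PA.countP (fun q => decide (r q.2.1 = i)) +
          PA.countP (fun q => decide (r q.2.2 = i)) = 0 := by
        rw [Nat.add_eq_zero_iff, List.countP_eq_zero, List.countP_eq_zero]
        constructor
        · intro q hq h
          obtain ⟨⟨u, hu, hqu⟩, -⟩ := hPAcls q hq
          simp only [decide_eq_true_eq] at h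
          exact hi ⟨u, hu, by rw [← hr u hu, ← hqu, h]⟩
        · intro q hq h
          obtain ⟨-, ⟨v, hv, hqv⟩⟩ := hPAcls q hq
          simp only [decide_eq_true_eq] at h
          exact hi ⟨v, hv, by rw [← hr v hv, ← hqv, h]⟩
      rw [h1, h2]
  refine ⟨d, ?_, PA', ⟨?_, ?_, hbal'⟩, uF (rk m x) PF,
    Submodule.subset_span ⟨PF, hcov, fun i => rfl, rfl⟩, ?_⟩
  · -- `∑ d = 2 |PF| ≤ 2 g`
    have hlt : ∀ p ∈ PF, rk m x p.first < gOf m := fun p hp => rk_lt m x (hends p hp).1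
    have hlt' : ∀ p ∈ PF, rk m x p.last < gOf m := fun p hp => rk_lt m x (hends p hp).2
    have h1 := sum_countP_eq_length (fun p : VSeq (Fin m) => rk m x p.first) PF hlt
    have h2 := sum_countP_eq_length (fun p : VSeq (Fin m) => rk m x p.last) PF hlt'
    have hsum : ∑ t, d t = PF.length + PF.length := by
      simp only [hd, fSlots, Finset.sum_add_distrib]
      rw [h1, h2]
    rw [hsum]
    have := length_le_card_of_cover hcov
    have := card_freeSet_le m
    omega
  · -- the A-cover, read in the anchored graph of the A-block
    have hmap : PA'.map Prod.fst = PA.map Prod.fst := by rw [hPA', List.map_map]; rfl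
    rw [hmap]
    refine isCoverOf_of_imp hcovA fun u hu v hv huv => ?_
    rw [adjA_iff]
    exact ⟨(mem_compl_freeSet_iff u).1 hu, (mem_compl_freeSet_iff v).1 hv, huv⟩
  · -- label validity against the class-membership table
    intro q' hq'
    rw [hPA'] at hq'
    obtain ⟨q, hq, rfl⟩ := List.mem_map.1 hq'
    obtain ⟨⟨u, hu, hqu⟩, ⟨v, hv, hqv⟩⟩ := hPAcls q hq
    obtain ⟨hf, hl⟩ := hlab q hq
    rw [aData_inr_iff, aData_inr_iff]
    exact ⟨⟨u, hu, by rw [hqu, hr u hu], by rw [← hqu]; exact hf⟩,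
      ⟨v, hv, by rw [hqv, hr v hv], by rw [← hqv]; exact hl⟩⟩
  · -- odd pairing, by cut parity
    rw [pairing_eq_one_iff x lab' hlab' PF hends d (fun i => rfl) PA' hbal']
    obtain ⟨u₀, hu₀⟩ := freeSet_nonempty hm
    have hPFne : PF ≠ [] := by
      rintro rfl
      have h0 := hcov.2.1
      rw [← h0] at hu₀
      simp at hu₀
    obtain ⟨p₀, hp₀⟩ := List.exists_mem_of_ne_nil PF hPFne
    have hsupp : ∀ i ∈ dsupp d, ∃ e ∈ freeSet m, rk m x e = (i : ℕ) ∧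
        0 < fSlots (cls m x) PF (cls m x e) := by
      intro i hi
      rw [mem_dsupp, hd, fSlots_pos_iff] at hi
      obtain ⟨p, hp, h | h⟩ := hi
      · exact ⟨p.first, (hends p hp).1, h, (fSlots_pos_iff _ _ _).2 ⟨p, hp, Or.inl rfl⟩⟩
      · exact ⟨p.last, (hends p hp).2, h, (fSlots_pos_iff _ _ _).2 ⟨p, hp, Or.inr rfl⟩⟩
    refine ⟨⟨lab' p₀.first, ?_⟩, fun i hi j hj => ?_⟩
    · rw [mem_dsupp, hd, fSlots_pos_iff]
      exact ⟨p₀, hp₀, Or.inl (hlab' _ (hends p₀ hp₀).1).symm⟩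
    · obtain ⟨e, he, hei, hpos⟩ := hsupp i hi
      obtain ⟨e', he', hej, hpos'⟩ := hsupp j hj
      have hR := reachable_rank_of_reachable_cls x r hr PF hends PA hPAcls (hreach _ _ hpos hpos')
      have hi' : r (cls m x e) = i := Fin.ext ((hr e he).trans hei)
      have hj' : r (cls m x e') = j := Fin.ext ((hr e' he').trans hej)
      rw [hi', hj'] at hR
      exact hR

/-- **(⇐)** From the residual predicate to the Kotzig interface: by linearity some generator
`uF (rk m x) PF` of `W_F(d)` pairs oddly, by cut parity the rank-labelled junction graph of
`(PF, PA)` is connected on the support of `d`; relabel the A-family by the classes of the ranks. -/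
theorem kotzigPred_of_residue₀ (hm : 4 ≤ m) (h : Residue₀ m x) :
    KotzigPred (Gr m x) (freeSet m) := by
  classical
  obtain ⟨d, -, PA, ⟨hcovA, hlabA, hbalA⟩, w, hw, hpair⟩ := h
  -- linearity: some generator pairs oddly
  obtain ⟨t, ⟨PF, hcov, hmarg, rfl⟩, hpair⟩ :=
    (exists_mem_span_pairing_iff _ (vA d PA)).1 ⟨w, hw, hpair⟩
  have hends := ends_mem x hcov
  obtain ⟨r, hr⟩ := exists_rankFin hm x
  set lab' : Fin m → Fin (gOf m) := fun v => r (cls m x v) with hlab'_def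
  have hlab' : ∀ u ∈ freeSet m, (lab' u : ℕ) = rk m x u := hr
  -- cut parity: the rank-labelled junction graph is connected on the support
  obtain ⟨-, hconn⟩ := (pairing_eq_one_iff x lab' hlab' PF hends d hmarg PA hbalA).1 hpair
  -- labels in use are ranks of free vertices
  have hPAgen : ∀ q ∈ PA,
      (∃ u ∈ freeSet m, rk m x u = q.2.1) ∧ (∃ u ∈ freeSet m, rk m x u = q.2.2) := by
    intro q hq
    obtain ⟨h1, h2⟩ := hlabA q hq
    rw [aData_inr_iff] at h1 h2
    obtain ⟨u, hu, hu', -⟩ := h1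
    obtain ⟨v, hv, hv', -⟩ := h2
    exact ⟨⟨u, hu, hu'⟩, ⟨v, hv, hv'⟩⟩
  obtain ⟨N, hN⟩ := exists_clsOfRank m x
  set PA' : List (VSeq (Fin m) × (Finset (Fin m) × Finset (Fin m))) :=
    PA.map fun q => (q.1, (N q.2.1, N q.2.2)) with hPA'
  refine ⟨PF, PA', hcov, ?_, ?_, ?_, ?_⟩
  · -- the A-cover, read in `Gr m x`
    have hmap : PA'.map Prod.fst = PA.map Prod.fst := by rw [hPA', List.map_map]; rfl
    rw [hmap]
    refine isCoverOf_of_imp hcovA fun u _ v _ huv => ?_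
    rw [adjA_iff] at huv
    exact huv.2.2
  · -- ends of A-paths lie in their label classes
    intro q' hq'
    rw [hPA'] at hq'
    obtain ⟨q, hq, rfl⟩ := List.mem_map.1 hq'
    obtain ⟨h1, h2⟩ := hlabA q hq
    rw [aData_inr_iff] at h1 h2
    obtain ⟨u, hu, hu', hfu⟩ := h1
    obtain ⟨v, hv, hv', hlv⟩ := h2
    dsimp only
    rw [← hu', ← hv', hN u hu, hN v hv]
    exact ⟨hfu, hlv⟩
  · -- balance at every class
    intro M
    change fSlots (cls m x) PF M = aSlots PA' M
    rw [hPA', aSlots_map PA (fun i : Fin (gOf m) => N i)]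
    by_cases hM : ∃ u ∈ freeSet m, cls m x u = M
    · obtain ⟨u₀, hu₀, rfl⟩ := hM
      let i₀ : Fin (gOf m) := ⟨rk m x u₀, rk_lt m x hu₀⟩
      have h1 : fSlots (cls m x) PF (cls m x u₀) = fSlots (rk m x) PF (i₀ : ℕ) := by
        apply fSlots_congr
        intro p hp
        refine ⟨⟨fun h => ?_, fun h => ?_⟩, ⟨fun h => ?_, fun h => ?_⟩⟩
        · exact congrArg (rankOf m x) h
        · exact cls_eq_of_rk_eq m x (hends p hp).1 hu₀ h
        · exact congrArg (rankOf m x) h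
        · exact cls_eq_of_rk_eq m x (hends p hp).2 hu₀ h
      have h2 : aSlots PA i₀ = PA.countP (fun q => decide (N q.2.1 = cls m x u₀)) +
          PA.countP (fun q => decide (N q.2.2 = cls m x u₀)) := by
        apply aSlots_congr PA i₀ (fun q => N q.2.1 = cls m x u₀) (fun q => N q.2.2 = cls m x u₀)
        intro q hq
        obtain ⟨⟨u, hu, hqu⟩, ⟨v, hv, hqv⟩⟩ := hPAgen q hq
        refine ⟨⟨fun h => ?_, fun h => ?_⟩, ⟨fun h => ?_, fun h => ?_⟩⟩
        · rw [h]; exact hN u₀ hu₀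
        · rw [← hqu, hN u hu] at h
          exact Fin.ext (hqu.symm.trans (congrArg (rankOf m x) h))
        · rw [h]; exact hN u₀ hu₀
        · rw [← hqv, hN v hv] at h
          exact Fin.ext (hqv.symm.trans (congrArg (rankOf m x) h))
      rw [h1, hmarg i₀, ← hbalA i₀, h2]
    · have h1 : fSlots (cls m x) PF M = 0 := by
        apply Nat.eq_zero_of_not_pos
        rw [fSlots_pos_iff]
        rintro ⟨p, hp, h | h⟩
        · exact hM ⟨_, (hends p hp).1, h⟩
        · exact hM ⟨_, (hends p hp).2, h⟩
      have h2 : PA.countP (fun q => decide (N q.2.1 = M)) +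
          PA.countP (fun q => decide (N q.2.2 = M)) = 0 := by
        rw [Nat.add_eq_zero_iff, List.countP_eq_zero, List.countP_eq_zero]
        constructor
        · intro q hq h
          obtain ⟨⟨u, hu, hqu⟩, -⟩ := hPAgen q hq
          simp only [decide_eq_true_eq] at h
          rw [← hqu, hN u hu] at h
          exact hM ⟨u, hu, h⟩
        · intro q hq h
          obtain ⟨-, ⟨v, hv, hqv⟩⟩ := hPAgen q hq
          simp only [decide_eq_true_eq] at h
          rw [← hqv, hN v hv] at h
          exact hM ⟨v, hv, h⟩
      rw [h1, h2]
  · -- connectivity of the class-labelled junction graph on its support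
    intro M M' hM hM'
    change 0 < fSlots (cls m x) PF M at hM
    change 0 < fSlots (cls m x) PF M' at hM'
    change (junctionGraph (cls m x) PF PA').Reachable M M'
    have hx : ∀ M, 0 < fSlots (cls m x) PF M →
        ∃ e ∈ freeSet m, cls m x e = M ∧ lab' e ∈ dsupp d := by
      intro M hM
      rw [fSlots_pos_iff] at hM
      obtain ⟨p, hp, h | h⟩ := hM
      · refine ⟨p.first, (hends p hp).1, h, ?_⟩
        rw [mem_dsupp, ← hmarg, fSlots_pos_iff]
        exact ⟨p, hp, Or.inl (hlab' _ (hends p hp).1).symm⟩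
      · refine ⟨p.last, (hends p hp).2, h, ?_⟩
        rw [mem_dsupp, ← hmarg, fSlots_pos_iff]
        exact ⟨p, hp, Or.inr (hlab' _ (hends p hp).2).symm⟩
    obtain ⟨e, he, rfl, hed⟩ := hx M hM
    obtain ⟨e', he', rfl, hed'⟩ := hx M' hM'
    have hR := reachable_cls_of_reachable_rank x lab' hlab' N hN PF hends PA hPAgen
      (hconn _ hed _ hed')
    rw [hlab' e he, hlab' e' he', hN e he, hN e' he'] at hR
    exact hR

end Main

end Cutspan

/-- **stub_cutspan** (line `kotzig-cutspan`, crux `SymmetryBudget.HamCompiles`;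
Bodlaender–Cygan–Kratsch–Nederlof cut parity + linearity). For `m ≥ 4` the Kotzig interface of
`Gr m x` (free set = the last `g(m)` vertices) holds iff the graph-level residual predicate
holds. -/
theorem stub_cutspan (m : ℕ) (hm : 4 ≤ m) (x : Fin m × Fin m → Bool) :
    KotzigPred (Gr m x) (freeSet m) ↔ Residue₀ m x :=
  ⟨Cutspan.residue₀_of_kotzigPred x hm, Cutspan.kotzigPred_of_residue₀ x hm⟩

end Summit.PneNP.PneNP.Theorems.HamCompilesKC
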